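/-
Copyright: the b2b-balaban cell (near-miss cell 7), T⁴-continuum fan-out, lineage t4-ne7b-p3 (node U5c LARGE-DEVIATION
member P3).  Released under the licence of the surrounding project.
-/
import Summits.QuantumFields.BalabanUV.T4Continuum.Support.SpaceTimeTagged
import Summits.QuantumFields.BalabanUV.T4Continuum.Support.SpaceTimeJunction

/-!
# Space-time Peierls ∕ Cramér route for NE7b — THE JUNCTION ON THE TAGGED LABEL: EVERY realised history (no
# `TypeNodup`) is a realised lineage (`SkelOK`) of the CONTOUR route, with its domain inside the route's `dom`

Summits-side support leaf of the T⁴-continuum cell (rung (B)+1 on a FINITE torus only; NOT infinite volume, NOT the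
mass gap, NOT the Clay statement; NOT a proof of the spine estimate NE7b).  Lineage `t4-ne7b-p3` (generation 3), node
U5c, skeleton `t4/skeletons/NE7b-t4-ne7b-p3.md` §14 (the TAGGED road).  [folklore] finite combinatorics: the proof of
`SpaceTimeJunction.skelOK_of_realises` (this lineage, p212044) re-run on the tagged label `SpaceTimeTagged.toGenT` with
tagged pieces — the distinctness of labels now comes from the tags (`tag_range`) instead of `TypeNodup`, the chronology
from `HistoryRealise.adm_of_realises` instead of a displayed `Adm`; glue lemmas of `SpaceTimeJunction` §1,
`SpaceTimeConnector`, `SpaceTimeRealised` ∕ `SpaceTimeRealisedCells`, and the COUNT swarm's `HistoryRealise.Realises` —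
all BY NAME; nothing printed is asserted; no `[cite:]` tag.

WHAT.
* §1 `tstep`, `tfat` (step and class of a tagged label), **`pieceOfT L s n P : ℕ × PEv → Finset ℤᵈ`** — the piece of
  the tagged event: a birth carries its region, a join the CONNECTOR about an `ε`-chosen skeleton point, other labels
  nothing; `pieceOfT_of_not_mem`.
* §2 **`skelOK_of_realisesT`**: `Realises L s R P Z → SkelOK (ratio L s) tstep (pieceOfT L s n P) tfat (127^d + 3)
  (toGenT n P) ∧ Z ⊆ dom (ratio L s) tstep (pieceOfT L s n P) (toGenT n P) P.lastStep` — for EVERY realised history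
  (`L ≥ 4`, drop control on every horizon); **`treeCells_le_of_realisesT`** (the cell binder).

HONEST DEPENDENCY (cell, verbatim): continuum YM on T⁴ ⇐ BetaPertH ∧ nine spine estimates (0/9 proved); BetaPertH ⇐
(D1) ∧ (D4) ∧ CAP+tail; G-an2-4 gates asym, D1 and NE2/3/4.  This file changes none of it.
-/

open Finset

namespace Summit.QuantumFields.BalabanUV.T4Continuum.SpaceTimePeierls

open Literature.MathematicalPhysics.QuantumFieldTheory.Balaban1983to89
open Literature.MathematicalPhysics.QuantumFieldTheory.Balaban1983to89.B13ScaleTransfer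
open Literature.MathematicalPhysics.QuantumFieldTheory.Balaban1983to89.TreeLength
open Literature.MathematicalPhysics.QuantumFieldTheory.Balaban1983to89.B16SProfile
open Literature.MathematicalPhysics.QuantumFieldTheory.Balaban1983to89.B16MergeGeometry (Touch)
open T4PersistenceDictionary
open Summit.QuantumFields.BalabanUV.T4Continuum.HistoryAdmissible
open Summit.QuantumFields.BalabanUV.T4Continuum.HistoryRealise

noncomputable section

/-! ## §1 Tagged steps, classes and pieces -/

section Pieces

variable {d : ℕ}

/-- the step of a tagged label [folklore] -/
def tstep : ℕ × PEv → ℕ := fun e => PEv.step e.2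

/-- the class of a tagged label [folklore] -/
def tfat : ℕ × PEv → ℕ := fun e => PEv.fat e.2

/-- the step of a tagged label, computed [folklore] -/
@[simp] theorem tstep_mk (n : ℕ) (e : PEv) : tstep (n, e) = PEv.step e := rfl

/-- the class of a tagged label, computed [folklore] -/
@[simp] theorem tfat_mk (n : ℕ) (e : PEv) : tfat (n, e) = PEv.fat e := rfl

/-- **THE TAGGED PIECES** of a history with birth payload `(anchor, region)` along the flow `(L, s)`, tags from `n`: the
birth label carries its region; the join label carries the CONNECTOR about a skeleton point of the endpoint partner
within radius `63` of the rest partner's skeleton (chosen by `Classical.epsilon`); every other label carries nothing.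
[folklore] -/
def pieceOfT (L : ℕ) (s : ℕ → ℕ) : ℕ → PGen (Pt d × Finset (Pt d)) → ℕ × PEv → Finset (Pt d)
  | n, .birth j cls zZ, e => if e = (n, ((j, 0, cls) : PEv)) then zZ.2 else ∅
  | n, .renew G _, e => pieceOfT L s (n + 1) G e
  | n, .join X Y sj, e =>
      if e = (n, ((sj, 2, 0) : PEv)) then
        connector (Classical.epsilon fun c : Pt d =>
          c ∈ skel (ratio L s) tstep (pieceOfT L s (n + 1) X) (toGenT (n + 1) X) sj ∧
            ∃ cY ∈ skel (ratio L s) tstep (pieceOfT L s (n + 1 + evCount X) Y) (toGenT (n + 1 + evCount X) Y) sj,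
              cY ∈ box c 63)
      else pieceOfT L s (n + 1) X e ∪ pieceOfT L s (n + 1 + evCount X) Y e

variable {L : ℕ} {s : ℕ → ℕ}

/-- labels outside the tagged history carry nothing [folklore] -/
theorem pieceOfT_of_not_mem :
    ∀ (n : ℕ) (P : PGen (Pt d × Finset (Pt d))) {e : ℕ × PEv}, e ∉ (toGenT n P).events → pieceOfT L s n P e = ∅
  | n, .birth j cls zZ, e, he => by
      simp only [toGenT, Gen.events_born, mem_singleton] at he
      simp [pieceOfT, he]
  | n, .renew G h, e, he => by
      simp only [toGenT, Gen.events_renew, mem_insert, not_or] at he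
      simp only [pieceOfT]
      exact pieceOfT_of_not_mem (n + 1) G he.2
  | n, .join X Y sj, e, he => by
      simp only [toGenT, Gen.events_merge, mem_insert, mem_union, not_or] at he
      simp only [pieceOfT, if_neg he.1]
      rw [pieceOfT_of_not_mem (n + 1) X he.2.1, pieceOfT_of_not_mem (n + 1 + evCount X) Y he.2.2, empty_union]

end Pieces

/-! ## §2 Every realised history is a realised lineage — on the tagged label, no `TypeNodup` -/

section Main

variable {d : ℕ} {L : ℕ} {s R : ℕ → ℕ}

/-- **THE JUNCTION THEOREM ON THE TAGGED LABEL.**  Along a flow with block size `L ≥ 4` and drop control on every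
horizon, EVERY history realised by a domain `Z` at its last event (`HistoryRealise.Realises`) is a realised lineage of
the CONTOUR route read on its tagged label with the tagged pieces and connector constant `127^d + 3` —
`SkelOK (ratio L s) tstep (pieceOfT L s n P) tfat (127^d + 3) (toGenT n P)` — and `Z ⊆ dom … (toGenT n P) P.lastStep`.
[folklore] -/
theorem skelOK_of_realisesT (hL : 4 ≤ L) (hdrop : ∀ m, DropCtl s m) :
    ∀ (n : ℕ) {P : PGen (Pt d × Finset (Pt d))} {Z : Finset (Pt d)}, Realises L s R P Z →
      SkelOK (ratio L s) tstep (pieceOfT L s n P) tfat ((127 : ℝ) ^ d + 3) (toGenT n P) ∧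
        Z ⊆ dom (ratio L s) tstep (pieceOfT L s n P) (toGenT n P) P.lastStep
  | n, .birth j cls zZ, Z, hRZ => by
      obtain ⟨hzZ, hz, hZc, hcls⟩ := hRZ
      have hpc : pieceOfT L s n (.birth j cls zZ) (n, ((j, 0, cls) : PEv)) = Z := by simp [pieceOfT, hzZ]
      refine ⟨⟨rfl, ?_, ?_, ?_⟩, ?_⟩
      · rw [hpc]; exact ⟨_, hz⟩
      · rw [hpc]; exact hZc
      · rw [hpc]; simpa using hcls
      · intro x hx
        show x ∈ dom (ratio L s) tstep (pieceOfT L s n (.birth j cls zZ)) (Gen.born (n, ((j, 0, cls) : PEv)) j) j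
        unfold dom iterAt
        rw [Gen.events_born, singleton_biUnion, tstep_mk, PEv.step_mk, Nat.sub_self, Siter_zero, hpc]
        exact hx
  | n, .renew G h, Z, hRZ => by
      obtain ⟨ZG, hRG, hready, -, rfl⟩ := hRZ
      have hAG : G.Adm G.lastStep := adm_of_realises G ZG hRG le_rfl
      have hGl : G.lastStep ≤ h := by have := hready.pos; omega
      obtain ⟨hok, hsub⟩ := skelOK_of_realisesT hL hdrop (n + 1) hRG
      have hnot : (n, ((h + 1, 1, 0) : PEv)) ∉ (toGenT (n + 1) G).events := fun hmem => by
        have := tag_range (n + 1) G _ hmem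
        simp at this
      have hpe : pieceOfT L s n (.renew G h) (n, ((h + 1, 1, 0) : PEv)) = ∅ := by
        simp only [pieceOfT]; exact pieceOfT_of_not_mem (n + 1) G hnot
      have hchron : ∀ e' ∈ (toGenT (n + 1) G).events, tstep e' ≤ h + 1 := fun e' he' =>
        (step_le_of_mem_toGenT hAG he').trans (by omega)
      refine ⟨⟨hok, hpe, rfl, hchron⟩, ?_⟩
      have hpe' : pieceOfT L s (n + 1) G (n, ((h + 1, 1, 0) : PEv)) = ∅ := hpe
      show orbit L s G.lastStep ZG (h + 1 - G.lastStep) ⊆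
        dom (ratio L s) tstep (pieceOfT L s (n + 1) G) (Gen.renew (toGenT (n + 1) G) (n, ((h + 1, 1, 0) : PEv)) h)
          (h + 1)
      rw [dom_renew _ _ hpe', orbit_eq_Siter]
      have key : dom (ratio L s) tstep (pieceOfT L s (n + 1) G) (toGenT (n + 1) G) (h + 1) =
          Siter (fun i => ratio L s (G.lastStep + i)) (h + 1 - G.lastStep)
            (dom (ratio L s) tstep (pieceOfT L s (n + 1) G) (toGenT (n + 1) G) G.lastStep) := by
        have hs := dom_shift (q := ratio L s) (step := tstep) (piece := pieceOfT L s (n + 1) G) (toGenT (n + 1) G)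
          (fun e' he' => step_le_of_mem_toGenT hAG he') (h + 1 - G.lastStep)
        rwa [show G.lastStep + (h + 1 - G.lastStep) = h + 1 by omega] at hs
      rw [key]
      exact Siter_mono _ hsub _
  | n, .join X Y sj, Z, hRZ => by
      obtain ⟨ZX, ZY, hRX, hRY, htX, htY, -, -, ⟨a, ha, c, hc, hac⟩, hZ⟩ := hRZ
      have hAX : X.Adm X.lastStep := adm_of_realises X ZX hRX le_rfl
      have hAY : Y.Adm Y.lastStep := adm_of_realises Y ZY hRY le_rfl
      obtain ⟨hokX, hsubX⟩ := skelOK_of_realisesT hL hdrop (n + 1) hRX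
      obtain ⟨hokY, hsubY⟩ := skelOK_of_realisesT hL hdrop (n + 1 + evCount X) hRY
      set nY := n + 1 + evCount X with hnY
      have hlbl_X : (n, ((sj, 2, 0) : PEv)) ∉ (toGenT (n + 1) X).events := fun hmem => by
        have := tag_range (n + 1) X _ hmem
        simp at this
      have hlbl_Y : (n, ((sj, 2, 0) : PEv)) ∉ (toGenT nY Y).events := fun hmem => by
        have := tag_range nY Y _ hmem
        simp only at this
        omega
      -- the combined pieces agree with the partners' pieces on their events (tags separate the partners)
      have hagX : ∀ e ∈ (toGenT (n + 1) X).events, (pieceOfT L s (n + 1) X) e = (pieceOfT L s n (.join X Y sj)) e := by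
        intro e he
        have hne : e ≠ (n, ((sj, 2, 0) : PEv)) := fun h => hlbl_X (h ▸ he)
        have heY : e ∉ (toGenT nY Y).events := fun h' => by
          have h1 := tag_range (n + 1) X e he
          have h2 := tag_range nY Y e h'
          omega
        simp only [pieceOfT, if_neg hne]
        rw [pieceOfT_of_not_mem nY Y heY, union_empty]
      have hagY : ∀ e ∈ (toGenT nY Y).events, (pieceOfT L s nY Y) e = (pieceOfT L s n (.join X Y sj)) e := by
        intro e he
        have hne : e ≠ (n, ((sj, 2, 0) : PEv)) := fun h => hlbl_Y (h ▸ he)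
        have heX : e ∉ (toGenT (n + 1) X).events := fun h' => by
          have h1 := tag_range (n + 1) X e h'
          have h2 := tag_range nY Y e he
          omega
        simp only [pieceOfT, if_neg hne]
        rw [pieceOfT_of_not_mem (n + 1) X heX, empty_union]
      -- chronology
      have hcX : ∀ e ∈ (toGenT (n + 1) X).events, tstep e ≤ sj := fun e he => (step_le_of_mem_toGenT hAX he).trans htX
      have hcY : ∀ e ∈ (toGenT nY Y).events, tstep e ≤ sj := fun e he => (step_le_of_mem_toGenT hAY he).trans htY
      -- the partners' images at the join step lie inside the route's domains
      have hdomX : orbit L s X.lastStep ZX (sj - X.lastStep) ⊆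
          dom (ratio L s) tstep (pieceOfT L s (n + 1) X) (toGenT (n + 1) X) sj := by
        rw [orbit_eq_Siter]
        have key : dom (ratio L s) tstep (pieceOfT L s (n + 1) X) (toGenT (n + 1) X) sj =
            Siter (fun i => ratio L s (X.lastStep + i)) (sj - X.lastStep)
              (dom (ratio L s) tstep (pieceOfT L s (n + 1) X) (toGenT (n + 1) X) X.lastStep) := by
          have hs := dom_shift (q := ratio L s) (step := tstep) (piece := pieceOfT L s (n + 1) X) (toGenT (n + 1) X)
            (fun e he => step_le_of_mem_toGenT hAX he) (sj - X.lastStep)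
          rwa [show X.lastStep + (sj - X.lastStep) = sj by omega] at hs
        rw [key]
        exact Siter_mono _ hsubX _
      have hdomY : orbit L s Y.lastStep ZY (sj - Y.lastStep) ⊆
          dom (ratio L s) tstep (pieceOfT L s nY Y) (toGenT nY Y) sj := by
        rw [orbit_eq_Siter]
        have key : dom (ratio L s) tstep (pieceOfT L s nY Y) (toGenT nY Y) sj =
            Siter (fun i => ratio L s (Y.lastStep + i)) (sj - Y.lastStep)
              (dom (ratio L s) tstep (pieceOfT L s nY Y) (toGenT nY Y) Y.lastStep) := by
          have hs := dom_shift (q := ratio L s) (step := tstep) (piece := pieceOfT L s nY Y) (toGenT nY Y)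
            (fun e he => step_le_of_mem_toGenT hAY he) (sj - Y.lastStep)
          rwa [show Y.lastStep + (sj - Y.lastStep) = sj by omega] at hs
        rw [key]
        exact Siter_mono _ hsubY _
      -- the skeleton pair from the touching images (read with the combined pieces, then transported back)
      have hL3 : 3 ≤ L := by omega
      obtain ⟨cX, hcXm, cY, hcYm, hnear⟩ := exists_skel_pair_of_touch (piece := pieceOfT L s n (.join X Y sj)) hL3
        (hdrop sj) (toGenT (n + 1) X) (toGenT nY Y) hcX hcY le_rfl
        (by rw [← dom_congr (toGenT (n + 1) X) hagX]; exact hdomX ha)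
        (by rw [← dom_congr (toGenT nY Y) hagY]; exact hdomY hc) (touch_iff_mem_block.1 hac)
      -- the chosen centre
      let spec : Pt d → Prop := fun c0 =>
        c0 ∈ skel (ratio L s) tstep (pieceOfT L s (n + 1) X) (toGenT (n + 1) X) sj ∧
          ∃ cY ∈ skel (ratio L s) tstep (pieceOfT L s nY Y) (toGenT nY Y) sj, cY ∈ box c0 63
      have hspec : spec (Classical.epsilon spec) :=
        Classical.epsilon_spec ⟨cX, by
          refine ⟨?_, cY, ?_, hnear⟩
          · rw [skel_congr (toGenT (n + 1) X) hagX]; exact hcXm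
          · rw [skel_congr (toGenT nY Y) hagY]; exact hcYm⟩
      obtain ⟨hc₀, cY', hcY', hnear'⟩ := hspec
      have hpe : (pieceOfT L s n (.join X Y sj)) (n, ((sj, 2, 0) : PEv)) = connector (Classical.epsilon spec) := by
        simp only [pieceOfT, if_true]
        rfl
      -- the partners' skeletons at the join step are face-connected
      have hL0 : 0 < L := by omega
      have hdC : (0 : ℝ) ≤ (127 : ℝ) ^ d + 3 := by positivity
      obtain ⟨-, hXfc, -⟩ := treeLen_skel_le (ratio_pos hL0 s) hdC hokX (n := sj)
        (by show PEv.step (toGenT (n + 1) X).top.2 ≤ sj; rw [snd_top_toGenT]; exact htX)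
      obtain ⟨-, hYfc, -⟩ := treeLen_skel_le (ratio_pos hL0 s) hdC hokY (n := sj)
        (by show PEv.step (toGenT nY Y).top.2 ≤ sj; rw [snd_top_toGenT]; exact htY)
      -- assemble the merge clause
      have hconn : FaceConnected
          (skel (ratio L s) tstep (pieceOfT L s n (.join X Y sj))
            (Gen.merge (toGenT (n + 1) X) (toGenT nY Y) (n, ((sj, 2, 0) : PEv))) sj) :=
        skel_merge_faceConnected (q := ratio L s) (piece := pieceOfT L s n (.join X Y sj))
          (by rw [← skel_congr (toGenT (n + 1) X) hagX]; exact hXfc)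
          (by rw [← skel_congr (toGenT nY Y) hagY]; exact hYfc)
          (by rw [← skel_congr (toGenT (n + 1) X) hagX]; exact hc₀)
          (by rw [← skel_congr (toGenT nY Y) hagY]; exact hcY') hnear' hpe
      refine ⟨⟨skelOK_congr hagX hokX, skelOK_congr hagY hokY, hcX, hcY, hconn,
        (connector_clause hpe le_rfl).1, (connector_clause hpe le_rfl).2⟩, ?_⟩
      -- the joined domain lies inside the union of the partners' images, hence inside `dom`
      simp only [toGenT, PGen.lastStep]
      rw [dom_merge]
      intro x hx
      rcases mem_union.1 (hZ hx) with hx | hx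
      · exact mem_union_right _ (mem_union_left _ (by rw [← dom_congr (toGenT (n + 1) X) hagX]; exact hdomX hx))
      · exact mem_union_right _ (mem_union_right _ (by rw [← dom_congr (toGenT nY Y) hagY]; exact hdomY hx))

/-- **THE CELL BINDER FOR EVERY REALISED HISTORY** (tagged form of `SpaceTimeJunction.treeCells_le_of_realises`):
`treeCells … (toGenT n P) t ≤ 8·126^d · treeD tfat tstep (127^d + 3) (toGenT n P) t + 126^d · treeSteps tstep
(toGenT n P) t`. [folklore] -/
theorem treeCells_le_of_realisesT (hL : 4 ≤ L) (hdrop : ∀ m, DropCtl s m) (n : ℕ)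
    {P : PGen (Pt d × Finset (Pt d))} {Z : Finset (Pt d)} (hRZ : Realises L s R P Z) (t : ℕ) :
    treeCells (ratio L s) tstep (pieceOfT L s n P) (toGenT n P) t ≤
      8 * 126 ^ d * treeD tfat tstep ((127 : ℝ) ^ d + 3) (toGenT n P) t +
        126 ^ d * treeSteps tstep (toGenT n P) t :=
  treeCells_le hL (hdrop t) (by positivity) (skelOK_of_realisesT hL hdrop n hRZ).1 (Nat.le_succ t)

end Main

end

end Summit.QuantumFields.BalabanUV.T4Continuum.SpaceTimePeierls
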